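import Literature.MathematicalPhysics.QuantumFieldTheory.BalabanImbrieJaffe1984to88.BIJ88Eq596BySteps
import Literature.MathematicalPhysics.QuantumFieldTheory.BalabanImbrieJaffe1984to88.BIJ88Eq240FlatTorus
import Literature.MathematicalPhysics.QuantumFieldTheory.BalabanImbrieJaffe1984to88.BIJ88Decay241FlatTorus
import Literature.MathematicalPhysics.QuantumFieldTheory.BalabanImbrieJaffe1984to88.BIJ88BlockGauge417

/-!
# `BalabanImbrieJaffe1984to88.BIJ88BgInvariance416Torus` — T. Bałaban, J. Imbrie, A. Jaffe, *Effective action and cluster properties of the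
abelian Higgs model*, Commun. Math. Phys. **114** (1988) 257–315 [BalabanImbrieJaffe1988], (4.16) p. 276 [PDF 20] with (4.4) p. 274,
(4.9)–(4.10) p. 275 and (5.1.4) p. 278: **THE INDUCTIVE ASSUMPTION (4.16) — *"every factor or term in our starting expression is gauge
invariant"* under the BACKGROUND gauge transformations — PROVED FOR THE CONCRETE FACTORS OF (4.1) ON THE TORUS**: the `ψ`-Gaussian with the
covariant average `Q(ū_k)φ` ((5.1.4)), the scalar field form `⟨Λ₈′φ, Δ_{k,loc}(u_k)Λ₈′φ⟩` ((2.34)/(4.1)), the scalar normalization factors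
`Z^{(j)}_{Λ₁₀}(u_k)` ((4.9) with `P(u_k) = Q(u_k)*Q(u_k)` (4.10)) and the restriction `|(D_{ū_k}φ)(b)|` ((4.5)) — each in the EXACT
hypothesis shape (`hQcov`, `hΔ`, `hZaway`) under which the C2.Eq5.9.6 head `BIJ88Eq596BySteps.eq596_bySteps` displays (4.16) as a clause.

statement-level skeleton of published theorems with citation tags; proofs where landed; nothing here is a claim about the Yang–Mills mass gap

PDF held: `paper:balaban1988-cmp114-bij-abelian-higgs-effective-action` (journal page = PDF page + 256).  Pages re-read AS IMAGES this
session: p. 274 [PDF 18], p. 277 [PDF 21], p. 278 [PDF 22] (r16's renders `HOME/lit-balaban-r16/renders/cmp114/original-p018/p021/p022-x2.png`)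
and p. 275 [PDF 19], p. 276 [PDF 20] (this seat's renders `renders/original-p019-x2.png`, `original-p020-x2.png`, same renderer).

CITATION HEADER (lean-in-tree rule).  Part of the lit-balaban TYPED SKELETON (HOME `run/shared/lean/pub/lit-balaban/`), PHASE-2 proof
seat p34 gen 15 (unit `lit-balaban-p34-g15`; TAKING line HOME/STATUS.md 2026-08-22T20:45:50Z, free-target protocol G.5-34(d); own lineage =
the C2 §5 measure-level density line (5.2.8) → (5.9.6) → (5.12.8) of gens 8–14).  Rows served (MEMBERS, no head claims): `C2.Eq4.16`
(owner r18, DEF row `BIJ88Sect4Statements.bgGaugeU`/`bgGaugePhi`/`BgInvariant` — the printed ASSUMPTION proved for the concrete factors),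
`C2.Eq4.4`, `C2.Eq4.9`, `C2.Eq4.10` (owner r18) and `C2.Eq5.9.6` (owner r16: the (4.16)-clauses K1 `hQcov`/`hΔ`/`hZaway` of the head
`eq596_bySteps`, flip ROWS-C2-part2 v2.166, are dischargeable BY NAME for the concrete torus slots below).

THE PRINTED TEXT (verbatim).  p. 276 [PDF 20]: *"Finally, we assume that every factor or term in our starting expression is gauge invariant
in the following senses. Gauge transformations u_{k,b} → u_{k,b}e^{−ie_kη(∂^ηλ)(b)}, φ(x) → φ(x)e^{ie_kλ(x)} (4.16) leave each expression
invariant. We will need to use only gauge transformations supported in Λ̄₁₃^{(k−1)}, so the terms in question are scalar field forms,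
interaction terms in 𝒫_{k,loc} renormalized observables F_{k,loc}, characteristic functions χ_{k,Λ₀^{(k−1)′}},"* p. 277 [PDF 21]: *"and the
normalization factors Z^{(j)}_{Λ^{(j)}_{10}}(u_k). However, all expressions possess this invariance, even those that are buried in the inductive
definition of g_k. Note that λ above is any real function on T_η, although only its values on T₁^{(k)} are relevant for φ. We call these
transformations background gauge transformations, because the integration variables u^{(j)}, u are not involved."*  p. 274 [PDF 18]: *"The
configuration u_k on T_η* gives a configuration ū_k on T₁^{(k)*} by taking a product along the bond in T₁^{(k)*}, i.e., ū_{k,b} = u_k(⟨b₋, b₊⟩).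
(4.4)"* and, in (4.5), *"|(D_{ū_k}φ)(b)| ≦ cp(e_k), b ∈ Λ₀^{(k−1)′*}"*.  p. 275 [PDF 19]: *"Similarly for the scalar field we have
Z^{(j)}_{Λ^{(j)}_{10}}(u_k) = ∫𝒟φ_{Λ^{(j)}_{10}} exp(−½⟨Λ^{(j)}_{10}φ, (Δ^{L^jη}_{j,loc}(u_k) + aL^{−2}P(u_k))Λ^{(j)}_{10}φ⟩ − E^{(j)}_{k,s}|Λ^{(j)}_{10}|), (4.9)
with P(u_k) = Q(u_k)*Q(u_k), (4.10)"*.  p. 278 [PDF 22]: *"Under gauge transformations λ of u, φ, u^{(j)} that vanish on points of T_L^{(k+1)},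
we see that the δ-functions and ρ′_k are invariant. Since u_k also transforms by λ, we have Q(u_k)φ invariant as well."*  [I] =
[BalabanImbrieJaffe1985] (CMP **97**) p. 302 (2.4) *"Here y = Ln denotes a corner of a block"*, p. 303 (2.7)–(2.8) *"φ_y → h(y)φ_y ≡ φ^h_y,
u_b → h(b₋)h(b₊)^{−1}u_b = u^h_b. (2.7) Clearly (Qφ)^h = Qφ^h. (2.8)"* (as quoted in r18's `BIJ85BlockAveragesTorus`).

THE READING (carriers of record; nothing re-declared).  `T_η` = the torus `Balaban1983to89.Site P j` (fine level `j`; `j = 0` where r18's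
`Term41` fixes it), `T₁^{(k)}` = `Site P (j+k)`, `T^{(k+1)}` = `Site P (j+k+1)`; the background `u_k` is a `U(1)` configuration
`U : GaugeField P j U1`, read in `ℂ` as `cfg U` where a slot of r18's `Term41` wants a ℂ-valued bond field; *"λ above is any real function on
T_η"* = `lam0 : Site P j → ℝ`, and *"its values on T₁^{(k)}"* are read at the CORNER points `cornerIter k` ([I] (2.4): the coarse lattices
ARE the lattices of block corners — p11/p31's convention of `BIJ85BlockAveragesTorusK`, in which p31's concrete `Δ_{k,loc}(u)`
(`BIJ88DeltaLoc234Torus.deltaLocT`) and `Q_k(u)` (`qMatT`) are gauge covariant with the phases `h(cornerIter k y)`).  (4.16) on the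
background: r18's `bgGaugeU e_k η λ` (= [I] (2.7) `gaugeAct` by the phase transformation `x ↦ e^{ie_kλ(x)} ∈ U(1)`, `phaseU1`; §1); on the
fields: r18's `bgGaugePhi e_k (λ∘cornerIter k)` (= p34's `twist`).  **(4.4) IN PRINT'S CORNER CONVENTION** (`barUc`, §2): one level of
(4.4) is the product of `u` along the straight run of `L` bonds from the corner of `B(c₋)` to the corner of `B(c₊)` (r18's `runC`,
`corner_shift`: *"Γ_{yy′} IS the run of L unit bonds from the corner"*), iterated `k` times — so that `ū_k`, `Q(ū_k)` (r18's (2.6) `qCov`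
at level `j+k`), `Δ_{k,loc}(u_k)` and `P(ū_k) = Q(ū_k)*Q(ū_k)` (p31's `pOp`) ALL transform with the SAME phases `h∘cornerIter k` on `T₁^{(k)}`
and `h∘cornerIter (k+1)` on `T^{(k+1)}`.  (r18's `BIJ88Sect4Statements.barU`/gen 7's `BIJ88RT51Background` read (4.4) with straight lines
between the block CENTRES `emb` — `Setup`'s B12 convention, DIVERGENCE F3 of SHARED-STRUCTURES; that twin transforms with `h∘embIter k` and is
not used here.)  (4.9): r18's `BIJ88Normalization46.Z49 T E N = e^{−EN}∫exp(−½vᵀTv)dv` with `T` = p31's REALIFIED (`realify`, two real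
coordinates per site) COMPRESSED (`compress Λ₁₀`, Dirichlet) precision `op240 (Δ_{k,loc}(u_k)) κ (ū_k) = Δ_{k,loc}(u_k) + κ·Q(ū_k)ᴴQ(ū_k)`
(`κ` = the printed `aL^{−2}` in p31's counting normalization) — exactly the argument of p31's flat-`u` instance `BIJ88Eq240FlatTorus.Z49_deltaLocT_flat`,
now at a GENERAL `U(1)` background (`prec49`, §5; `prec49_pureGauge` recovers p31's argument at `u_k = 1^h`).

WHAT IS PROVED (kernel-checked; 0 `sorry`; definitions with bodies `phaseU1`, `toU1`, `toU1Field`, `cornerLine`, `barUc`, `prec49`, `z49Slot`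
+ theorems; NO `Prop`-valued fact; standard axioms).
* §1 **(4.16) ↔ [I] (2.7)**: `bgGaugeU_cfg` (`u_{k,b}e^{−ie_kη(∂^ηλ)(b)} = (u_k^{h_λ})_b` read in `ℂ`, `h_λ = e^{ie_kλ}`, every `η ≠ 0`),
  `bgGaugePhi_eq_twist_phaseU1`; the retraction `toU1 : ℂ → U(1)` (`toC_toU1_of_norm`, `toU1_toC`, `toU1Field_cfg`) through which a
  ℂ-valued background slot is read as a `U(1)` configuration.
* §2 **(4.4), corner convention**: `cornerLine`/`barUc` with `toC_cornerLine` (= r18's `runC` from the corner), **`barUc_gaugeAct`**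
  (`ū_k(u^h) = (ū_k(u))^{h∘cornerIter k}` — (2.7) telescopes along the lines), `barUc_one`, `barUc_pureGauge` (`ū_k(1^h) = 1^{h∘cornerIter k}`).
* §3 **(5.1.4) for the concrete `Q(ū_k)φ`**: `qCov_barUc_gaugeAct` ((2.8): `Q(ū_k(u^h))(h∘cornerIter k · φ) = (h∘cornerIter (k+1))·Q(ū_k)φ`),
  **`qCov_barUc_bg`** = THE SHAPE `hQcov` of `eq596_bySteps` for the slot `QB := qCov ∘ barUc k ∘ toU1Field` with `λ_k = λ∘cornerIter k`,
  `λ_L = λ∘cornerIter (k+1)`; `gaussQuad_barUc_bg` (the `ψ`-Gaussian `½aL⁻²|ψ − Q(ū_k)φ|²` is invariant when `ψ` is rotated by `λ_L`).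
* §4 **(4.16) for the scalar field form with p31's `Δ_{k,loc}(u_k)`**: `deltaLocT_bg_apply` (kernel form), **`scalarForm_deltaLocT_bg`** = THE
  SHAPE `hΔ` for any `Term41 P (0+k)` whose `Δloc` slot is `deltaLocT` read through `toU1Field` (gen 13's `scalarForm_bg_of_kernel` fed by
  p31's `deltaLocT_gaugeAct_apply`).
* §5 **(4.16) for `Z^{(j)}_{Λ₁₀}(u_k)` of (4.9)**: the change of variables `v ↦ Rᵀv` in the Gaussian integral for an orthogonal `R`
  (`integral_comp_mulVec_of_abs_det`, Lebesgue measure on `ℝ^ι` is preserved when `|det| = 1` — Mathlib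
  `Real.map_matrix_volume_pi_eq_smul_volume_pi`; **`Z49_conj_orthogonal`**: `Z49 (RTRᵀ) = Z49 T`); the realification is a `*`-homomorphism
  (p31's `realify_mul`/`realify_one` BY NAME (v1.1), `realify_conjTranspose`) so a unitary becomes an orthogonal matrix (`realify_orthogonal_of_unitary`);
  compression commutes with diagonal sandwiches (`compress_diagonal_sandwich`); `pOp_gaugeAct` ((4.10) is covariant), **`prec49_gaugeAct`**
  (`Δ_{k,loc}(u^h) + κP(ū_k(u^h)) = M_h(Δ_{k,loc}(u) + κP(ū_k(u)))M_hᴴ`, `M_h = diag(h∘cornerIter k)`), **`Z49_prec49_gaugeAct`** and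
  **`z49Slot_bg`** = THE SHAPE `hZaway` for the slot `Zs j := Z49 ∘ realify ∘ compress Λ₁₀ ∘ prec49 ∘ toU1Field` — for EVERY `U(1)`
  background, every `λ`, every site set `Λ₁₀`, every cube/weight/cut-off datum, `κ`, `E`, `N` (no positivity needed: the identity holds for
  the integral as a number, convergent or not).
* §6 **(4.16) for the restriction `|(D_{ū_k}φ)(b)|` of (4.5)**: `norm_covD_barUc_bg` (p11's `covD_gaugeAct` for `ū_k`).
* §7 (v1.1, append-only) **(4.16) for the restrictions (5.2.2)** `χ_x`, `χ_y`, `χ_b`: `norm_bgGaugePhi_apply`, `norm_sub_qCov_barUc_bg`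
  (`|(ψ′ − Q(ū′_k)φ′)(y)| = |(ψ − Q(ū_k)φ)(y)|`), **`restrictions522_bg`** (any profile `χ`, any radii, any finite index sets).
* §8 (v1.2, append-only) **(4.9) for the concrete slot EVALUATED at every pure-gauge background `u_k = 1^h`**: `z49Slot_pureGauge_eq` —
  p31's `BIJ88Eq240FlatTorus.Z49_deltaLocT_flat` ((2.38)/(2.40) positivity of `Δ_{k,loc}` at flat `u`, his hypotheses VERBATIM) read for
  `z49Slot` via `prec49_pureGauge`/`toU1Field_cfg`: the realified compressed precision is positive definite,
  `z49Slot … (cfg 1^h) = e^{−E_sN}√(2π)^{2|Λ|}/√det(…)` and `0 < z49Slot … (cfg 1^h)` — at these backgrounds the `Z^{(j)}`-slot of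
  `BIJ88Eq596BgTorus.eq596_bySteps_bgTorus` is a convergent Gaussian integral, not a formal one (the estimate is p31's, by name).
HONEST SCOPE.  Exact algebraic/measure-theoretic identities; no bound is proved in this file (§8's positivity is p31's (2.38)-chain
`Z49_deltaLocT_flat`, imported by name, at PURE-GAUGE backgrounds only — positivity at general small backgrounds is not addressed).  The interaction `𝒫_{k,loc}` (p. 275: *"described in detail in a
later paper"*, row C2.Txt@275 a deferral) and the renormalized observables `F_{k,loc}` have no body in the tree — their (4.16) stays the
printed assumption (clause `hPinv` of `eq596_bySteps`); the characteristic functions are covered through the `|D_{ū_k}φ|` entry of (4.5) and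
(v1.1) the (5.2.2) restrictions `χ_x`, `χ_y`, `χ_b` (the `f^{(k)}(p)`/`χ_p` entries involve the integration variable `u`, not `u_k`); the
smoothed PRODUCT structure of r16's `χ_{k,Λ₀′}` of record is not unfolded here (any profile `χ`, §7).  r18's predicate `BIJ88Sect4Statements.BgInvariant` is the SAME-LEVEL form of (4.16) (`u`, `φ` both on `T^{(j)}`); the statements here
are in print's two-level form (`u_k` on `T_η`, `φ` on `T₁^{(k)}`, *"only its values on T₁^{(k)} are relevant for φ"*).  The joint instance of `eq596_bySteps` with these slots (readings `hQread`/`hPread`/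
`hZread` for a concrete term) is not built here.  Imports: gen 13's `BIJ88Eq596BySteps`, p31's `BIJ88Eq240FlatTorus` (→ `BIJ88DeltaLoc234Torus`) and (v1.1)
`BIJ88Decay241FlatTorus`, r18's `BIJ88BlockGauge417` (Literature + Mathlib only).  v1.1 = v1.0 (p341628) + §7 appended + one import (p31's `BIJ88Decay241FlatTorus`), MINUS the two v1.0 theorems
`realify_mul`/`realify_one`, which restated p31's identically-named theorems landed nine minutes before v1.0 (gate `dedup.landed` on the
v1.1 preflight) and are now taken by name; every other v1.0 declaration unchanged.  v1.2 = v1.1 (p342714) + §8 appended (one theorem; nothing else changed).  Seat p34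
gen 15, 2026-08-22.  NOT summit progress.
-/

open scoped BigOperators Matrix ComplexConjugate
open Finset Matrix Complex MeasureTheory

namespace Literature.MathematicalPhysics.QuantumFieldTheory.BalabanImbrieJaffe1984to88.BIJ88BgInvariance416Torus

open Literature.MathematicalPhysics.QuantumFieldTheory.Balaban1983to89
open BIJ88Sect3Statements (U1 toC cfg covD toC_mul toC_one toC_inv norm_toC)
open BIJ88Sect3Rescaling (toC_injective_U1)
open BIJ85Sect1Model (HiggsField)
open BIJ85RT33 (twist twist_apply)
open BIJ85BlockAveragesTorus (corner runSite runBond runC runC_gaugeAct corner_shift expU1 toC_expU1 qCov qCov_gaugeAct_twist toC_gaugeAct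
  toC_ne_zero)
open BIJ85BlockAveragesTorusK (cornerIter)
open BIJ88Sect4Statements (bgGaugeU bgGaugePhi)
open BIJ88BlockGauge417 (bgGaugePhi_eq_twist)
open BIJ88InductiveForm41 (Term41 scalarForm)
open BIJ88Eq596Sectors (gaussQuad)
open BIJ88Eq596BySteps (gaussQuad_bgGaugePhi scalarForm_bg_of_kernel)
open BIJ88NeumannNoZeroModesTorus (IsBlockUnion)
open BIJ88NeumannPropagator227Torus (toC_mul_conj conj_mul_toC)
open BIJ88DeltaLoc234Torus (mulOp mulOpK qMatT deltaLocT deltaLocT_gaugeAct deltaLocT_gaugeAct_apply qMatT_gaugeAct conjTranspose_mul_mulOpK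
  mulOp_mul_conjTranspose conjTranspose_mul_mulOp)
open BIJ88Normalization46 (Z49)
open BIJ88Eq240FlatTorus (realify compress cplx pOp op240)
open BIJ88Decay241FlatTorus (realify_mul realify_one)
open BIJ85ScalarPropagatorTorusK (covD_gaugeAct)
open GaugeField (gaugeAct)

noncomputable section

variable {P : Params} {j : ℕ}

/-! ## §1 (4.16) ↔ [I] (2.7): the background gauge transformation as a `U(1)` gauge transformation -/

/-- The phase gauge transformation `h_λ(x) = e^{ie_kλ(x)} ∈ U(1)` of the background gauge transformation (4.16) (r18's `expU1`).
[cite: BalabanImbrieJaffe1988, (4.16) p.276] -/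
def phaseU1 (ek : ℝ) (lam : Balaban1983to89.Site P j → ℝ) : GaugeTransf P j U1 := fun x => expU1 (ek * lam x)

/-- kernel: `h_λ(x)` read in `ℂ` is `e^{ie_kλ(x)}`. [cite: BalabanImbrieJaffe1988, (4.16) p.276] -/
theorem toC_phaseU1 (ek : ℝ) (lam : Balaban1983to89.Site P j → ℝ) (x : Balaban1983to89.Site P j) :
    toC (phaseU1 ek lam x) = Complex.exp (I * (ek * lam x : ℝ)) := by
  rw [phaseU1, toC_expU1, mul_comm]

/-- kernel: `conj e^{ie_kλ(x)} = e^{−ie_kλ(x)}`. [cite: BalabanImbrieJaffe1988, (4.16) p.276] -/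
theorem conj_toC_phaseU1 (ek : ℝ) (lam : Balaban1983to89.Site P j → ℝ) (x : Balaban1983to89.Site P j) :
    (starRingEnd ℂ) (toC (phaseU1 ek lam x)) = Complex.exp (-(I * (ek * lam x : ℝ))) := by
  rw [toC_phaseU1, ← Complex.exp_conj, map_mul, Complex.conj_I, Complex.conj_ofReal, neg_mul]

/-- **(4.16), the scalar field**: `φ(x) → φ(x)e^{ie_kλ(x)}` IS the rotation `φ ↦ h_λφ` of [I] (2.7) (r18's `bgGaugePhi_eq_twist`).
[cite: BalabanImbrieJaffe1988, (4.16) p.276] -/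
theorem bgGaugePhi_eq_twist_phaseU1 (ek : ℝ) (lam : Balaban1983to89.Site P j → ℝ) (φ : HiggsField P j) :
    bgGaugePhi ek lam φ = twist (phaseU1 ek lam) φ :=
  bgGaugePhi_eq_twist ek lam φ

/-- **(4.16), the gauge field, on a `U(1)` background**: `u_{k,b}e^{−ie_kη(∂^ηλ)(b)}` is the configuration `u_k^{h_λ}` of [I] (2.7)
(`u^h_b = h(b₋)u_bh(b₊)^{−1}`) read in `ℂ` — for every spacing `η ≠ 0` (r18's `bgGaugeU_one_eq_cfg_gaugeAct` is `η = 1`).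
[cite: BalabanImbrieJaffe1988, (4.16) p.276] -/
theorem bgGaugeU_cfg {ek η : ℝ} (hη : η ≠ 0) (lam : Balaban1983to89.Site P j → ℝ) (U : GaugeField P j U1) :
    bgGaugeU ek η lam (cfg U) = cfg (gaugeAct (phaseU1 ek lam) U) := by
  funext b
  simp only [bgGaugeU, cfg, toC_gaugeAct, phaseU1, toC_expU1, LatticeFieldCalculus.grad, smul_eq_mul]
  rw [show ek * η * (η⁻¹ * (lam b.tgt - lam b.src)) = ek * (lam b.tgt - lam b.src) by field_simp]
  rw [← Complex.exp_neg, mul_comm (cexp _) (toC (U b)), mul_assoc, ← Complex.exp_add]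
  congr 1
  push_cast
  ring

/-- The retraction `ℂ → U(1)` by the argument, `z ↦ e^{i arg z}` — the device by which a ℂ-valued background slot of r18's `Term41`
(`PBond P 0 → ℂ`) is read as a `U(1)` configuration. [cite: BalabanImbrieJaffe1988, (4.16) p.276] -/
def toU1 (z : ℂ) : U1 := expU1 (Complex.arg z)

/-- kernel: on the unit circle the retraction is the identity in `ℂ`. [cite: BalabanImbrieJaffe1988, (4.16) p.276] -/
theorem toC_toU1_of_norm {z : ℂ} (hz : ‖z‖ = 1) : toC (toU1 z) = z := by
  rw [toU1, toC_expU1]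
  have h := Complex.norm_mul_exp_arg_mul_I z
  rwa [hz, Complex.ofReal_one, one_mul] at h

/-- kernel: `toU1 (toC g) = g`. [cite: BalabanImbrieJaffe1988, (4.16) p.276] -/
theorem toU1_toC (g : U1) : toU1 (toC g) = g := toC_injective_U1 (toC_toU1_of_norm (norm_toC g))

/-- kernel: `toU1 1 = 1`. [cite: BalabanImbrieJaffe1988, (4.16) p.276] -/
theorem toU1_one : toU1 (1 : ℂ) = 1 := by rw [← toC_one, toU1_toC]

/-- The ℂ-valued bond field read as a `U(1)` configuration, bondwise `toU1`. [cite: BalabanImbrieJaffe1988, (4.16) p.276] -/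
def toU1Field (u : PBond P j → ℂ) : GaugeField P j U1 := fun b => toU1 (u b)

/-- kernel: reading `cfg U` back gives `U`. [cite: BalabanImbrieJaffe1988, (4.16) p.276] -/
theorem toU1Field_cfg (U : GaugeField P j U1) : toU1Field (cfg U) = U := funext fun b => toU1_toC (U b)

/-- kernel: hence the (4.16)-transform of `cfg U`, read back, is the transformed configuration `U^{h_λ}`.
[cite: BalabanImbrieJaffe1988, (4.16) p.276] -/
theorem toU1Field_bgGaugeU_cfg {ek η : ℝ} (hη : η ≠ 0) (lam : Balaban1983to89.Site P j → ℝ) (U : GaugeField P j U1) :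
    toU1Field (bgGaugeU ek η lam (cfg U)) = gaugeAct (phaseU1 ek lam) U := by
  rw [bgGaugeU_cfg hη, toU1Field_cfg]

/-! ## §2 (4.4) in print's corner convention: `ū_k` by straight lines between the block corners -/

/-- kernel: a transport along a run of `U(1)` bond variables is unimodular. [cite: BalabanImbrieJaffe1988, (4.4) p.274] -/
theorem norm_runC (U : GaugeField P j U1) (x : Balaban1983to89.Site P j) (μ : Fin P.d) : ‖runC U x μ‖ = 1 := by
  rw [runC, norm_prod]
  exact Finset.prod_eq_one fun t _ => norm_toC _

/-- **One level of (4.4), corner convention**: `ū_c = u(Γ_{yy′})`, the transport along the straight run of `L` bonds from the corner `y` of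
`B(c₋)` to the corner `y′` of `B(c₊)` ([I] (2.10): *"Γ_{yy′} = b′"*; r18's `runC` from `corner c.src`), as a `U(1)` element.
[cite: BalabanImbrieJaffe1988, (4.4) p.274] -/
def cornerLine (U : GaugeField P j U1) : GaugeField P (j+1) U1 := fun c => toU1 (runC U (corner c.src) c.dir)

/-- kernel: `ū_c` read in `ℂ` is the run product. [cite: BalabanImbrieJaffe1988, (4.4) p.274] -/
theorem toC_cornerLine (U : GaugeField P j U1) (c : PBond P (j+1)) : toC (cornerLine U c) = runC U (corner c.src) c.dir :=
  toC_toU1_of_norm (norm_runC U _ _)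

/-- **(2.7) telescopes along the line**: `ū(u^h) = (ū(u))^{h∘corner}` (the run ends at the corner of the next block, r18's `corner_shift`;
standing range `j + 1 ≤ m + K`). [cite: BalabanImbrieJaffe1985, (2.7) p.303] -/
theorem cornerLine_gaugeAct (hj : j + 1 ≤ P.m + P.K) (h : GaugeTransf P j U1) (U : GaugeField P j U1) :
    cornerLine (gaugeAct h U) = gaugeAct (fun y => h (corner y)) (cornerLine U) := by
  funext c
  apply toC_injective_U1
  rw [toC_cornerLine, toC_gaugeAct, toC_cornerLine, runC_gaugeAct, ← corner_shift hj]
  rfl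

/-- kernel: the line product of the trivial configuration is trivial. [cite: BalabanImbrieJaffe1988, (4.4) p.274] -/
theorem cornerLine_one : cornerLine (1 : GaugeField P j U1) = 1 := by
  funext c
  apply toC_injective_U1
  rw [toC_cornerLine, runC]
  rw [Finset.prod_eq_one fun t _ => by exact toC_one]
  exact toC_one.symm

/-- **(4.4) p. 274, verbatim: *"The configuration u_k on T_η* gives a configuration ū_k on T₁^{(k)*} by taking a product along the bond in
T₁^{(k)*}, i.e., ū_{k,b} = u_k(⟨b₋, b₊⟩). (4.4)"* — IN PRINT'S CORNER CONVENTION** ([I] (2.4) *"y = Ln denotes a corner of a block"*): the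
`k`-fold iterate of `cornerLine`, from the fine lattice `T^{(j)}` to `T^{(j+k)}` (the straight line `⟨b₋, b₊⟩` of `L^k` fine bonds between the
corner images `cornerIter k b₋`, `cornerIter k b₊`).  (r18's `BIJ88Sect4Statements.barU` is the same product between the block CENTRES —
DIVERGENCE F3; not used here.) [cite: BalabanImbrieJaffe1988, (4.4) p.274] -/
def barUc : (k : ℕ) → GaugeField P j U1 → GaugeField P (j+k) U1
  | 0 => fun U => U
  | k + 1 => fun U => cornerLine (barUc k U)

/-- kernel: `ū_0 = u`. [cite: BalabanImbrieJaffe1988, (4.4) p.274] -/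
theorem barUc_zero (U : GaugeField P j U1) : barUc 0 U = U := rfl

/-- kernel: `ū_{k+1} = ū(ū_k)` (one more level of lines). [cite: BalabanImbrieJaffe1988, (4.4) p.274] -/
theorem barUc_succ (k : ℕ) (U : GaugeField P j U1) : barUc (k+1) U = cornerLine (barUc k U) := rfl

/-- **(4.4) under the gauge transformations of `T_η`** — p. 277: *"the above transformations induce the gauge transformation u_{k,b} →
u_{k,b}exp[−ie_kη(∂^ηQ′*_kλ)]"* / p. 278 *"u_k also transforms by λ"*, read for `ū_k`: **`ū_k(u^h) = (ū_k(u))^{h∘cornerIter k}`** — the unit-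
lattice field of `u^h` is the gauge transform of `ū_k(u)` by `h` RESTRICTED TO THE CORNER POINTS of `T₁^{(k)}` in `T_η` (every `U(1)`
configuration, every `h`, standing range `j + k ≤ m + K`). [cite: BalabanImbrieJaffe1988, (4.4) p.274] -/
theorem barUc_gaugeAct : ∀ (k : ℕ), j + k ≤ P.m + P.K → ∀ (h : GaugeTransf P j U1) (U : GaugeField P j U1),
    barUc k (gaugeAct h U) = gaugeAct (fun y => h (cornerIter k y)) (barUc k U)
  | 0, _, _, _ => rfl
  | k + 1, hk, h, U => by
    rw [barUc_succ, barUc_succ, barUc_gaugeAct k (by omega) h U, cornerLine_gaugeAct (by omega)]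
    rfl

/-- kernel: `ū_k(1) = 1`. [cite: BalabanImbrieJaffe1988, (4.4) p.274] -/
theorem barUc_one : ∀ k : ℕ, barUc k (1 : GaugeField P j U1) = 1
  | 0 => rfl
  | k + 1 => by rw [barUc_succ, barUc_one k, cornerLine_one]

/-- **`ū_k` of a pure gauge is the pure gauge at the corner points**: `ū_k(1^h) = 1^{h∘cornerIter k}` — the unit-lattice background of p31's
flat-`u` files (`BIJ88Eq240FlatTorus.Z49_deltaLocT_flat` takes `gaugeAct (h∘cornerIter k) 1` as its `P(u_k)`-argument).
[cite: BalabanImbrieJaffe1988, (4.4) p.274] -/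
theorem barUc_pureGauge {k : ℕ} (hk : j + k ≤ P.m + P.K) (h : GaugeTransf P j U1) :
    barUc k (gaugeAct h (1 : GaugeField P j U1)) = gaugeAct (fun y => h (cornerIter k y)) (1 : GaugeField P (j+k) U1) := by
  rw [barUc_gaugeAct k hk, barUc_one]

/-! ## §3 (5.1.4) *"Since u_k also transforms by λ, we have Q(u_k)φ invariant as well"* for the concrete `Q(ū_k)φ` -/

section QSlot

variable {k : ℕ}

/-- **[I] (2.8) for `Q(ū_k)`**: under `u ↦ u^h` on `T_η` and `φ ↦ (h∘cornerIter k)·φ` on `T₁^{(k)}`, the covariant block average picks up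
the phase at the corner of the block: `Q(ū_k(u^h))((h∘cornerIter k)φ)(y) = h(cornerIter (k+1) y)·(Q(ū_k(u))φ)(y)` (r18's
`qCov_gaugeAct_twist` for `ū_k`, §2 `barUc_gaugeAct`; standing range). [cite: BalabanImbrieJaffe1985, (2.8) p.303] -/
theorem qCov_barUc_gaugeAct (hk : j + k + 1 ≤ P.m + P.K) (h : GaugeTransf P j U1) (U : GaugeField P j U1)
    (φ : HiggsField P (j+k)) (y : Balaban1983to89.Site P (j+k+1)) :
    qCov (barUc k (gaugeAct h U)) (twist (fun x => h (cornerIter k x)) φ) y = toC (h (cornerIter (k+1) y)) * qCov (barUc k U) φ y := by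
  rw [barUc_gaugeAct k (by omega) h U, qCov_gaugeAct_twist hk]
  rfl

/-- **(5.1.4) p. 278 IN THE (4.16) CURRENCY — THE SHAPE `hQcov` OF `BIJ88Eq596BySteps.eq596_bySteps`**: for the slot `Q_B(u_k)φ :=
Q(ū_k(u_k))φ` (background read through `toU1Field`), the transformed background `u_{k,b}e^{−ie_kη(∂^ηλ)(b)}` and the rotated field
`φe^{ie_kλ_k}`, `λ_k = λ∘cornerIter k`, give the ROTATED average: `Q_B(u′_k)φ′ = e^{ie_kλ_L}·Q_B(u_k)φ` with `λ_L = λ∘cornerIter (k+1)` — verbatim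
*"Since u_k also transforms by λ, we have Q(u_k)φ invariant as well"* up to the common rotation of `ψ` and `Q(u_k)φ` (p. 282 (5.4.5)),
for EVERY `U(1)` background `u_k`, every `λ` on `T_η`, every `e_k`, `η ≠ 0` (standing range). [cite: BalabanImbrieJaffe1988, (5.1.4) p.278] -/
theorem qCov_barUc_bg (hk : j + k + 1 ≤ P.m + P.K) {ek η : ℝ} (hη : η ≠ 0) (lam0 : Balaban1983to89.Site P j → ℝ) (U : GaugeField P j U1)
    (φ : HiggsField P (j+k)) :
    qCov (barUc k (toU1Field (bgGaugeU ek η lam0 (cfg U)))) (bgGaugePhi ek (fun x : Balaban1983to89.Site P (j+k) => lam0 (cornerIter k x)) φ) =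
      bgGaugePhi ek (fun y : Balaban1983to89.Site P (j+k+1) => lam0 (cornerIter (k+1) y)) (qCov (barUc k (toU1Field (cfg U))) φ) := by
  rw [toU1Field_bgGaugeU_cfg hη, toU1Field_cfg]
  funext y
  rw [bgGaugePhi_eq_twist_phaseU1,
    show phaseU1 ek (fun x : Balaban1983to89.Site P (j+k) => lam0 (cornerIter k x)) = fun x => phaseU1 ek lam0 (cornerIter k x) from rfl,
    qCov_barUc_gaugeAct hk]
  simp only [bgGaugePhi, toC_phaseU1]
  ring

/-- **The `ψ`-Gaussian of (5.1.1)/(5.2.8) is (4.16)-invariant for the concrete `Q(ū_k)`**: `½aL⁻²|ψ′ − Q_B(u′_k)φ′|² = ½aL⁻²|ψ − Q_B(u_k)φ|²`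
when `ψ′ = ψe^{ie_kλ_L}` (gen 13's `gaussQuad_bgGaugePhi` after `qCov_barUc_bg`). [cite: BalabanImbrieJaffe1988, (5.1.4) p.278] -/
theorem gaussQuad_barUc_bg (hk : j + k + 1 ≤ P.m + P.K) {ek η : ℝ} (hη : η ≠ 0) (a : ℝ) (lam0 : Balaban1983to89.Site P j → ℝ)
    (U : GaugeField P j U1) (φ : HiggsField P (j+k)) (ψ : HiggsField P (j+k+1)) :
    gaussQuad (P := P) (k := j + k) a (qCov (barUc k (toU1Field (bgGaugeU ek η lam0 (cfg U)))) (bgGaugePhi ek (fun x : Balaban1983to89.Site P (j+k) => lam0 (cornerIter k x)) φ))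
        (bgGaugePhi ek (fun y : Balaban1983to89.Site P (j+k+1) => lam0 (cornerIter (k+1) y)) ψ) =
      gaussQuad (P := P) (k := j + k) a (qCov (barUc k (toU1Field (cfg U))) φ) ψ := by
  rw [qCov_barUc_bg hk hη, gaussQuad_bgGaugePhi]

end QSlot

/-! ## §4 (4.16) for the scalar field form `⟨Λ₈′φ, Δ_{k,loc}(u_k)Λ₈′φ⟩` with p31's concrete `Δ_{k,loc}` -/

section DeltaSlot

variable {ι : Type*} [Fintype ι] {k : ℕ}

/-- **The kernel form of (4.16) for `Δ_{k,loc}(u_k)`**: at the transformed background `u_{k,b}e^{−ie_kη(∂^ηλ)(b)}` the entries of p31's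
`Δ_{k,loc}` pick up the phases `e^{ie_kλ(cornerIter k y₁)}`, `e^{−ie_kλ(cornerIter k y₂)}` (p31's `deltaLocT_gaugeAct_apply` at `h_λ`; every
cube family of `k`-block unions, every weight/cut-off datum, `a > 0`, `c ≠ 0`, `η ≠ 0`, standing range).
[cite: BalabanImbrieJaffe1988, (4.16) p.276] -/
theorem deltaLocT_bg_apply (hk : j + k ≤ P.m + P.K) {a c ek η : ℝ} (hc : c ≠ 0) (ha : 0 < a) (hη : η ≠ 0)
    {cube : ι → Finset (Balaban1983to89.Site P j)} (hcube : ∀ α, IsBlockUnion k (cube α))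
    (lam : ι → Balaban1983to89.Site P j → Balaban1983to89.Site P j → ℝ) (ζ'' : Balaban1983to89.Site P j → Balaban1983to89.Site P j → ℝ)
    (lam0 : Balaban1983to89.Site P j → ℝ) (U : GaugeField P j U1) (y₁ y₂ : Balaban1983to89.Site P (j+k)) :
    deltaLocT a c (toU1Field (bgGaugeU ek η lam0 (cfg U))) k cube lam ζ'' y₁ y₂ =
      Complex.exp (I * (ek * lam0 (cornerIter k y₁) : ℝ)) * deltaLocT a c (toU1Field (cfg U)) k cube lam ζ'' y₁ y₂ *
        Complex.exp (-(I * (ek * lam0 (cornerIter k y₂) : ℝ))) := by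
  rw [toU1Field_bgGaugeU_cfg hη, toU1Field_cfg, deltaLocT_gaugeAct_apply hk hc ha (phaseU1 ek lam0) U hcube, toC_phaseU1, conj_toC_phaseU1]

/-- **(4.16) FOR THE SCALAR FIELD FORM OF (4.1) — THE SHAPE `hΔ` OF `BIJ88Eq596BySteps.eq596_bySteps`**: for every term `T : Term41 P (0+k)`
whose `Δ_{k,loc}` slot IS p31's concrete `deltaLocT` (background read through `toU1Field`; any cube family of `k`-block unions, weights,
cut-off, `a > 0`, `c ≠ 0`), every `U(1)` background `u_k` on `T_η`, every `λ` on `T_η`, `e_k`, `η ≠ 0`: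
`⟨Λ₈′φ′, Δ_{k,loc}(u′_k)Λ₈′φ′⟩ = ⟨Λ₈′φ, Δ_{k,loc}(u_k)Λ₈′φ⟩` with `u′_k = u_ke^{−ie_kη∂^ηλ}`, `φ′ = φe^{ie_kλ_k}`, `λ_k = λ∘cornerIter k` (r18's
`scalarForm`; gen 13's `scalarForm_bg_of_kernel` fed by `deltaLocT_bg_apply`). (*"the terms in question are scalar field forms …"*, p. 276.)
[cite: BalabanImbrieJaffe1988, (4.16) p.276] -/
theorem scalarForm_deltaLocT_bg (hk : 0 + k ≤ P.m + P.K) {a c ek η : ℝ} (hc : c ≠ 0) (ha : 0 < a) (hη : η ≠ 0)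
    {cube : ι → Finset (Balaban1983to89.Site P 0)} (hcube : ∀ α, IsBlockUnion k (cube α))
    (lam : ι → Balaban1983to89.Site P 0 → Balaban1983to89.Site P 0 → ℝ) (ζ'' : Balaban1983to89.Site P 0 → Balaban1983to89.Site P 0 → ℝ)
    (T : Term41 P (0 + k)) (hT : ∀ ukf y₁ y₂, T.Δloc ukf y₁ y₂ = deltaLocT a c (toU1Field ukf) k cube lam ζ'' y₁ y₂)
    (lam0 : Balaban1983to89.Site P 0 → ℝ) (U : GaugeField P 0 U1) (φ : HiggsField P (0 + k)) :
    scalarForm T (bgGaugeU ek η lam0 (cfg U)) (bgGaugePhi ek (fun x : Balaban1983to89.Site P (0+k) => lam0 (cornerIter k x)) φ) = scalarForm T (cfg U) φ :=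
  scalarForm_bg_of_kernel T ek η lam0 (fun x : Balaban1983to89.Site P (0+k) => lam0 (cornerIter k x)) (cfg U) φ fun y₁ _ y₂ _ => by
    rw [hT, hT, deltaLocT_bg_apply hk hc ha hη hcube]

end DeltaSlot

/-! ## §5 (4.16) for the scalar normalization factors `Z^{(j)}_{Λ₁₀}(u_k)` of (4.9) -/

section Gaussian

variable {ι : Type*} [Fintype ι] [DecidableEq ι]

/-- **Lebesgue measure on `ℝ^ι` is invariant under a linear map of determinant `±1`**: `∫g(Rv)dv = ∫g(v)dv` for `|det R| = 1` (Mathlib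
`Real.map_matrix_volume_pi_eq_smul_volume_pi`; the change of variables in the Gaussian integral (4.9)). [cite: BalabanImbrieJaffe1988, (4.9) p.275] -/
theorem integral_comp_mulVec_of_abs_det {R : Matrix ι ι ℝ} (hR : |R.det| = 1) (g : (ι → ℝ) → ℝ) :
    ∫ v : ι → ℝ, g (R *ᵥ v) = ∫ v : ι → ℝ, g v := by
  have hdet : R.det ≠ 0 := fun h => by simp [h] at hR
  have hmp : MeasurePreserving (toLin' R) volume volume := by
    refine ⟨(toLin' R).continuous_of_finiteDimensional.measurable, ?_⟩
    rw [Real.map_matrix_volume_pi_eq_smul_volume_pi hdet, abs_inv, hR, inv_one, ENNReal.ofReal_one, one_smul]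
  have hdet' : LinearMap.det (toLin' R) ≠ 0 := by rwa [LinearMap.det_toLin']
  let e : (ι → ℝ) ≃L[ℝ] (ι → ℝ) := (LinearMap.equivOfDetNeZero (toLin' R) hdet').toContinuousLinearEquiv
  have he : MeasurableEmbedding (toLin' R) := by
    have hme := e.toHomeomorph.measurableEmbedding
    have hfun : (toLin' R : (ι → ℝ) → (ι → ℝ)) = e.toHomeomorph := by
      funext v; rfl
    rw [hfun]; exact hme
  have h := hmp.integral_comp he g
  simpa only [Matrix.toLin'_apply] using h

/-- **`Z49 (RTRᵀ) = Z49 T` FOR AN ORTHOGONAL `R`** — r18's (4.9) Gaussian integral `e^{−EN}∫exp(−½vᵀTv)dv` is invariant under an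
orthogonal conjugation of the precision matrix (substitute `v ↦ Rᵀv`; no positivity or convergence hypothesis: an identity of the
integrals as numbers). [cite: BalabanImbrieJaffe1988, (4.9) p.275] -/
theorem Z49_conj_orthogonal {R : Matrix ι ι ℝ} (hR : Rᵀ * R = 1) (T : Matrix ι ι ℝ) (E N : ℝ) : Z49 (R * T * Rᵀ) E N = Z49 T E N := by
  unfold Z49
  congr 1
  have hdet : |(Rᵀ).det| = 1 := by
    have h := congrArg Matrix.det hR
    rw [det_mul, det_transpose, det_one] at h
    rw [det_transpose]
    rcases mul_self_eq_one_iff.1 h with h1 | h1 <;> simp [h1]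
  rw [← integral_comp_mulVec_of_abs_det hdet (fun v => Real.exp (-(1 / 2 : ℝ) * (v ⬝ᵥ T *ᵥ v)))]
  refine integral_congr_ae (Filter.Eventually.of_forall fun v => ?_)
  simp only
  congr 2
  rw [← mulVec_mulVec, ← mulVec_mulVec, dotProduct_mulVec v R, ← mulVec_transpose]

omit [Fintype ι] [DecidableEq ι] in
/-- kernel: the entries of p31's realification. [cite: BalabanImbrieJaffe1988, (4.9) p.275] -/
theorem realify_apply (M : Matrix ι ι ℂ) (p q : ι × Fin 2) :
    realify M p q = if p.2 = 0 then (if q.2 = 0 then (M p.1 q.1).re else -(M p.1 q.1).im)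
      else (if q.2 = 0 then (M p.1 q.1).im else (M p.1 q.1).re) := rfl

/- v1.1: the v1.0 theorems `realify_mul`, `realify_one` of this section restated p31's `BIJ88Decay241FlatTorus.realify_mul`/`realify_one`
(landed 2026-08-22T20:59:59Z, nine minutes before v1.0 of this file — the gate's dedup check for v1.0 ran on the earlier tree); they are
now TAKEN BY NAME from p31's file (`open BIJ88Decay241FlatTorus (realify_mul realify_one)`), as the gate's `dedup.landed` rule asks. -/

omit [Fintype ι] [DecidableEq ι] in
/-- kernel: the realification of the adjoint is the transpose: `realify Mᴴ = (realify M)ᵀ`. [cite: BalabanImbrieJaffe1988, (4.9) p.275] -/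
theorem realify_conjTranspose (M : Matrix ι ι ℂ) : realify Mᴴ = (realify M)ᵀ := by
  ext p q
  obtain ⟨i, a⟩ := p
  obtain ⟨l, b⟩ := q
  rw [transpose_apply, realify_apply, realify_apply, conjTranspose_apply]
  simp only
  fin_cases a <;> fin_cases b <;> simp [Complex.conj_re, Complex.conj_im]

/-- **A unitary becomes an orthogonal matrix**: `Uᴴ U = 1 ⟹ (realify U)ᵀ(realify U) = 1`. [cite: BalabanImbrieJaffe1988, (4.9) p.275] -/
theorem realify_orthogonal_of_unitary {U : Matrix ι ι ℂ} (hU : Uᴴ * U = 1) : (realify U)ᵀ * realify U = 1 := by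
  rw [← realify_conjTranspose, ← realify_mul, hU, realify_one]

/-- **`Z49` of a realified precision is invariant under a unitary conjugation of the complex precision**:
`Z49 (realify (UNUᴴ)) = Z49 (realify N)` for `UᴴU = 1`. [cite: BalabanImbrieJaffe1988, (4.9) p.275] -/
theorem Z49_realify_conj_unitary {U : Matrix ι ι ℂ} (hU : Uᴴ * U = 1) (N : Matrix ι ι ℂ) (E Nn : ℝ) :
    Z49 (realify (U * N * Uᴴ)) E Nn = Z49 (realify N) E Nn := by
  rw [realify_mul, realify_mul, realify_conjTranspose]
  exact Z49_conj_orthogonal (realify_orthogonal_of_unitary hU) _ E Nn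

end Gaussian

section Compress

variable {S : Type*} [Fintype S] [DecidableEq S]

/-- kernel: p31's compression (`|_Λ`, Dirichlet) of a diagonal sandwich is the sandwich of the compression by the compressed diagonal.
[cite: BalabanImbrieJaffe1988, (4.9) p.275] -/
theorem compress_diagonal_sandwich (Λ : Finset S) (d : S → ℂ) (A : Matrix S S ℂ) :
    compress Λ (diagonal d * A * (diagonal d)ᴴ) =
      diagonal (fun x : ↥Λ => d x) * compress Λ A * (diagonal (fun x : ↥Λ => d x))ᴴ := by
  ext x y
  simp only [compress, submatrix_apply, diagonal_conjTranspose, mul_diagonal, diagonal_mul, Pi.star_apply]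

/-- kernel: a diagonal of `U(1)` phases (restricted to `Λ`) is unitary. [cite: BalabanImbrieJaffe1988, (4.9) p.275] -/
theorem conjTranspose_mul_diagonal_toC {n : Type*} [Fintype n] [DecidableEq n] (g : n → U1) :
    (diagonal fun i => toC (g i))ᴴ * diagonal (fun i => toC (g i)) = 1 := by
  rw [diagonal_conjTranspose, diagonal_mul_diagonal, ← diagonal_one]
  congr 1
  funext i
  rw [Pi.star_apply, Complex.star_def, conj_mul_toC]

end Compress

section ZSlot

variable {ι : Type*} [Fintype ι] {k : ℕ}

/-- **(4.10) is gauge covariant**: `P(v^g) = M_gP(v)M_gᴴ` for the one-step average `Q(v)` on the unit lattice (`P = QᴴQ`, p31's `pOp`;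
`M_g = diag(g)`; from p31's (2.8) matrix identity `qMatT_gaugeAct`; standing range `n + 1 ≤ m + K`). [cite: BalabanImbrieJaffe1988, (4.10) p.275] -/
theorem pOp_gaugeAct {n : ℕ} (hn : n + 1 ≤ P.m + P.K) (g : GaugeTransf P n U1) (V : GaugeField P n U1) :
    pOp (gaugeAct g V) = mulOp g * pOp V * (mulOp g)ᴴ := by
  rw [pOp, pOp, qMatT_gaugeAct hn, conjTranspose_mul, conjTranspose_mul, conjTranspose_conjTranspose]
  have h1 : (mulOpK g 1)ᴴ * mulOpK g 1 = 1 := conjTranspose_mul_mulOpK g 1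
  calc mulOp g * ((qMatT V 1)ᴴ * (mulOpK g 1)ᴴ) * (mulOpK g 1 * qMatT V 1 * (mulOp g)ᴴ)
      = mulOp g * (qMatT V 1)ᴴ * ((mulOpK g 1)ᴴ * mulOpK g 1) * qMatT V 1 * (mulOp g)ᴴ := by simp only [Matrix.mul_assoc]
    _ = mulOp g * ((qMatT V 1)ᴴ * qMatT V 1) * (mulOp g)ᴴ := by rw [h1, Matrix.mul_one]; simp only [Matrix.mul_assoc]

/-- kernel: the two diagonal phase matrices agree — `M^{(k)}_h` on `T₁^{(k)}` (phases `h(cornerIter k y)`) IS `M_{h∘cornerIter k}`.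
[cite: BalabanImbrieJaffe1985, (2.8) p.303] -/
theorem mulOpK_eq_mulOp (h : GaugeTransf P j U1) (k : ℕ) : mulOpK h k = mulOp (fun y => h (cornerIter k y)) := rfl

/-- **The precision operator of (4.9) WITH BODY at a general `U(1)` background**: `Δ^{L^jη}_{j,loc}(u_k) + κ·P(ū_k)` on `ℓ²(T₁^{(k)})` —
p31's `op240 (deltaLocT a c u k cube λ ζ″) κ (ū_k u)` with `ū_k` the corner-convention (4.4) `barUc` (`κ` = the printed `aL^{−2}` in p31's
counting normalization; p31's flat-`u` instance `Z49_deltaLocT_flat` is the case `u = 1^h`, see `prec49_pureGauge`).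
[cite: BalabanImbrieJaffe1988, (4.9) p.275] -/
def prec49 (a c : ℝ) (U : GaugeField P j U1) (k : ℕ) (cube : ι → Finset (Balaban1983to89.Site P j))
    (lam : ι → Balaban1983to89.Site P j → Balaban1983to89.Site P j → ℝ) (ζ'' : Balaban1983to89.Site P j → Balaban1983to89.Site P j → ℝ) (κ : ℝ) :
    Matrix (Balaban1983to89.Site P (j+k)) (Balaban1983to89.Site P (j+k)) ℂ :=
  op240 (deltaLocT a c U k cube lam ζ'') κ (barUc k U)

/-- kernel: at a pure gauge `u_k = 1^h` the precision is p31's flat-`u` argument `op240 (deltaLocT … (1^h) …) κ (1^{h∘cornerIter k})`.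
[cite: BalabanImbrieJaffe1988, (4.9) p.275] -/
theorem prec49_pureGauge (hk : j + k ≤ P.m + P.K) (a c : ℝ) (h : GaugeTransf P j U1) (cube : ι → Finset (Balaban1983to89.Site P j))
    (lam : ι → Balaban1983to89.Site P j → Balaban1983to89.Site P j → ℝ) (ζ'' : Balaban1983to89.Site P j → Balaban1983to89.Site P j → ℝ) (κ : ℝ) :
    prec49 a c (gaugeAct h (1 : GaugeField P j U1)) k cube lam ζ'' κ =
      op240 (deltaLocT a c (gaugeAct h (1 : GaugeField P j U1)) k cube lam ζ'') κ
        (gaugeAct (fun y => h (cornerIter k y)) (1 : GaugeField P (j+k) U1)) := by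
  rw [prec49, barUc_pureGauge hk]

/-- **(4.16) for the precision of (4.9): `Δ_{k,loc}(u^h) + κP(ū_k(u^h)) = M^{(k)}_h(Δ_{k,loc}(u) + κP(ū_k(u)))M^{(k)}_hᴴ`** (p31's
`deltaLocT_gaugeAct` and `pOp_gaugeAct` after `barUc_gaugeAct` — the SAME phases `h(cornerIter k y)` for both summands; cube family of
`k`-block unions, `a > 0`, `c ≠ 0`, standing range `j + k + 1 ≤ m + K`). [cite: BalabanImbrieJaffe1988, (4.16) p.276] -/
theorem prec49_gaugeAct (hk : j + k + 1 ≤ P.m + P.K) {a c : ℝ} (hc : c ≠ 0) (ha : 0 < a) (h : GaugeTransf P j U1) (U : GaugeField P j U1)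
    {cube : ι → Finset (Balaban1983to89.Site P j)} (hcube : ∀ α, IsBlockUnion k (cube α))
    (lam : ι → Balaban1983to89.Site P j → Balaban1983to89.Site P j → ℝ) (ζ'' : Balaban1983to89.Site P j → Balaban1983to89.Site P j → ℝ) (κ : ℝ) :
    prec49 a c (gaugeAct h U) k cube lam ζ'' κ = mulOpK h k * prec49 a c U k cube lam ζ'' κ * (mulOpK h k)ᴴ := by
  rw [prec49, prec49, op240, op240, barUc_gaugeAct k (by omega) h U, pOp_gaugeAct (by omega), deltaLocT_gaugeAct (by omega) hc ha h U hcube,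
    ← mulOpK_eq_mulOp, Matrix.mul_add, Matrix.add_mul, Matrix.mul_smul, Matrix.smul_mul]

/-- **(4.16) FOR `Z^{(j)}_{Λ₁₀}(u_k)` OF (4.9) — p. 277: *"and the normalization factors Z^{(j)}_{Λ^{(j)}_{10}}(u_k)"***: r18's `Z49` of the
realified compressed precision is INVARIANT under `u ↦ u^h`: `Z^{(j)}_{Λ₁₀}(u_k^h) = Z^{(j)}_{Λ₁₀}(u_k)` — every `U(1)` background, every gauge
transformation `h` of `T_η`, every site set `Λ₁₀ ⊂ T₁^{(k)}`, every cube/weight/cut-off datum, `κ`, `E`, `N` (the phases conjugate the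
precision by a unitary diagonal, whose realification is orthogonal; the Lebesgue measure `𝒟φ_{Λ₁₀}` is invariant).
[cite: BalabanImbrieJaffe1988, (4.9) p.275] -/
theorem Z49_prec49_gaugeAct (hk : j + k + 1 ≤ P.m + P.K) {a c : ℝ} (hc : c ≠ 0) (ha : 0 < a) (h : GaugeTransf P j U1) (U : GaugeField P j U1)
    {cube : ι → Finset (Balaban1983to89.Site P j)} (hcube : ∀ α, IsBlockUnion k (cube α))
    (lam : ι → Balaban1983to89.Site P j → Balaban1983to89.Site P j → ℝ) (ζ'' : Balaban1983to89.Site P j → Balaban1983to89.Site P j → ℝ) (κ : ℝ)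
    (Λ : Finset (Balaban1983to89.Site P (j+k))) (E N : ℝ) :
    Z49 (realify (compress Λ (prec49 a c (gaugeAct h U) k cube lam ζ'' κ))) E N =
      Z49 (realify (compress Λ (prec49 a c U k cube lam ζ'' κ))) E N := by
  rw [prec49_gaugeAct hk hc ha h U hcube, mulOpK, compress_diagonal_sandwich]
  exact Z49_realify_conj_unitary (conjTranspose_mul_diagonal_toC fun x : ↥Λ => h (cornerIter k (x : Balaban1983to89.Site P (j+k)))) _ E N

/-- **The `Z^{(j)}_{Λ₁₀}(u_k)`-slot with body**: `Zs(u_k) := Z49 (realify ((Δ_{k,loc}(u_k) + κP(ū_k))|_{Λ₁₀})) E N` as a function of the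
ℂ-valued background (read through `toU1Field`) — the shape of r18's `Term41.Zs j : (PBond P 0 → ℂ) → ℝ`.
[cite: BalabanImbrieJaffe1988, (4.9) p.275] -/
def z49Slot (a c : ℝ) (k : ℕ) (cube : ι → Finset (Balaban1983to89.Site P j))
    (lam : ι → Balaban1983to89.Site P j → Balaban1983to89.Site P j → ℝ) (ζ'' : Balaban1983to89.Site P j → Balaban1983to89.Site P j → ℝ) (κ : ℝ)
    (Λ : Finset (Balaban1983to89.Site P (j+k))) (E N : ℝ) (ukf : PBond P j → ℂ) : ℝ :=
  Z49 (realify (compress Λ (prec49 a c (toU1Field ukf) k cube lam ζ'' κ))) E N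

/-- **(4.16) FOR `Z^{(j)}_{Λ₁₀}(u_k)` IN THE (4.16) CURRENCY — THE SHAPE `hZaway` OF `BIJ88Eq596BySteps.eq596_bySteps`** (p. 283: *"We can
gauge away the term ∂C_kΛ₃^{(k)*}A′, leaving us with the following background gauge field for the normalization factors"*): for every
`U(1)` background `u_k` on `T_η`, every gauge function `λ_Z` on `T_η`, `e_k`, `η ≠ 0`: `Zs(u_k) = Zs(u_ke^{−ie_kη∂^ηλ_Z})`.
[cite: BalabanImbrieJaffe1988, (4.16) p.276] -/
theorem z49Slot_bg (hk : j + k + 1 ≤ P.m + P.K) {a c : ℝ} (hc : c ≠ 0) (ha : 0 < a)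
    {cube : ι → Finset (Balaban1983to89.Site P j)} (hcube : ∀ α, IsBlockUnion k (cube α))
    (lam : ι → Balaban1983to89.Site P j → Balaban1983to89.Site P j → ℝ) (ζ'' : Balaban1983to89.Site P j → Balaban1983to89.Site P j → ℝ) (κ : ℝ)
    (Λ : Finset (Balaban1983to89.Site P (j+k))) (E N : ℝ) {ek η : ℝ} (hη : η ≠ 0) (lamZ : Balaban1983to89.Site P j → ℝ) (U : GaugeField P j U1) :
    z49Slot a c k cube lam ζ'' κ Λ E N (cfg U) = z49Slot a c k cube lam ζ'' κ Λ E N (bgGaugeU ek η lamZ (cfg U)) := by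
  rw [z49Slot, z49Slot, toU1Field_bgGaugeU_cfg hη, toU1Field_cfg, Z49_prec49_gaugeAct hk hc ha (phaseU1 ek lamZ) U hcube]

end ZSlot

/-! ## §6 (4.16) for the restriction `|(D_{ū_k}φ)(b)|` of (4.5) -/

section Restriction

variable {k : ℕ}

/-- **(4.16) for the covariant derivative entry of (4.5)**, *"|(D_{ū_k}φ)(b)| ≦ cp(e_k)"*: `|(D_{ū_k(u′_k)}φ′)(b)| = |(D_{ū_k(u_k)}φ)(b)|` for
`u′_k = u_ke^{−ie_kη∂^ηλ}`, `φ′ = φe^{ie_kλ_k}`, `λ_k = λ∘cornerIter k` — so a characteristic function of `|(D_{ū_k}φ)(b)|` is (4.16)-invariant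
(p11's `covD_gaugeAct` for `ū_k`, §2 `barUc_gaugeAct`; any constant `c₀`, every `U(1)` background, `η ≠ 0`, standing range).
[cite: BalabanImbrieJaffe1988, (4.5) p.274] -/
theorem norm_covD_barUc_bg (hk : j + k ≤ P.m + P.K) {ek η : ℝ} (hη : η ≠ 0) (c₀ : ℝ) (lam0 : Balaban1983to89.Site P j → ℝ)
    (U : GaugeField P j U1) (φ : HiggsField P (j+k)) (b : PBond P (j+k)) :
    ‖covD c₀ (cfg (barUc k (toU1Field (bgGaugeU ek η lam0 (cfg U))))) (bgGaugePhi ek (fun x : Balaban1983to89.Site P (j+k) => lam0 (cornerIter k x)) φ) b‖ =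
      ‖covD c₀ (cfg (barUc k (toU1Field (cfg U)))) φ b‖ := by
  rw [toU1Field_bgGaugeU_cfg hη, toU1Field_cfg, barUc_gaugeAct k hk, bgGaugePhi_eq_twist_phaseU1]
  have h := covD_gaugeAct c₀ (fun y => phaseU1 ek lam0 (cornerIter k y)) (barUc k U) φ b
  rw [show twist (phaseU1 ek fun x : Balaban1983to89.Site P (j+k) => lam0 (cornerIter k x)) φ =
      fun x => toC (phaseU1 ek lam0 (cornerIter k x)) * φ x from rfl, h,
    norm_mul, norm_toC, one_mul]

end Restriction

/-! ## §7 (v1.1, append-only) (4.16) for the restrictions (5.2.2): `χ_x`, `χ_y`, `χ_b` -/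

section Restrictions522

variable {k : ℕ}

/-- kernel: **the rotation (4.16) of the scalar field preserves `|φ(x)|`** — so `χ_x = χ(λ_kp(e_k), |φ(x)|)` of (5.2.2) is (4.16)-invariant
(any level, any gauge function). [cite: BalabanImbrieJaffe1988, (5.2.2) p.278] -/
theorem norm_bgGaugePhi_apply {n : ℕ} (ek : ℝ) (lam : Balaban1983to89.Site P n → ℝ) (φ : HiggsField P n) (x : Balaban1983to89.Site P n) :
    ‖bgGaugePhi ek lam φ x‖ = ‖φ x‖ := by
  rw [bgGaugePhi, norm_mul, BIJ88Eq596BySteps.norm_exp_I_mul_real, mul_one]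

/-- **(4.16) for the restriction `χ_y = χ(p(e_k), |(ψ − Q(u_k)φ)(y)|)` of (5.2.2)** with the CONCRETE `Q(ū_k)`: the transformed
background `u_{k,b}e^{−ie_kη(∂^ηλ)(b)}` with the rotated fields `φe^{ie_kλ_k}`, `ψe^{ie_kλ_L}` (`λ_k = λ∘cornerIter k`, `λ_L = λ∘cornerIter (k+1)`,
(5.4.5)) leaves `|(ψ − Q(ū_k)φ)(y)|` unchanged at every block point `y` (§3 `qCov_barUc_bg`; every `U(1)` background, `η ≠ 0`, standing
range). [cite: BalabanImbrieJaffe1988, (5.2.2) p.278] -/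
theorem norm_sub_qCov_barUc_bg (hk : j + k + 1 ≤ P.m + P.K) {ek η : ℝ} (hη : η ≠ 0) (lam0 : Balaban1983to89.Site P j → ℝ)
    (U : GaugeField P j U1) (φ : HiggsField P (j+k)) (ψ : HiggsField P (j+k+1)) (y : Balaban1983to89.Site P (j+k+1)) :
    ‖bgGaugePhi ek (fun y : Balaban1983to89.Site P (j+k+1) => lam0 (cornerIter (k+1) y)) ψ y -
        qCov (barUc k (toU1Field (bgGaugeU ek η lam0 (cfg U)))) (bgGaugePhi ek (fun x : Balaban1983to89.Site P (j+k) => lam0 (cornerIter k x)) φ) y‖ =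
      ‖ψ y - qCov (barUc k (toU1Field (cfg U))) φ y‖ := by
  rw [qCov_barUc_bg hk hη]
  simp only [bgGaugePhi]
  rw [← sub_mul, norm_mul, BIJ88Eq596BySteps.norm_exp_I_mul_real, mul_one]

/-- **The three `u_k`/`φ`-dependent restrictions of (5.2.2) are (4.16)-invariant for the concrete slots** — `χ_x` (`|φ(x)|`), `χ_y`
(`|(ψ − Q(ū_k)φ)(y)|`), `χ_b` (`|(D_{ū_k}φ)(b)|`): for EVERY real profile `χ` of two arguments, every radii, every `U(1)` background, every
`λ` on `T_η` and `η ≠ 0`, the product `Π_xχ(r_x,|φ′(x)|)·Π_yχ(r_y,|(ψ′ − Q(ū′_k)φ′)(y)|)·Π_bχ(r_b,|(D_{ū′_k}φ′)(b)|)` over any finite site/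
block-point/bond sets equals the unprimed product (`χ_p = χ(e_kp(e_k), |u(p) − 1|)` involves the integration variable `u` only) — the
*"characteristic functions χ_{k,Λ₀^{(k−1)′}}"* entry of the p. 276 list for these factors. [cite: BalabanImbrieJaffe1988, (5.2.2) p.278] -/
theorem restrictions522_bg (hk : j + k + 1 ≤ P.m + P.K) {ek η : ℝ} (hη : η ≠ 0) (χ : ℝ → ℝ → ℝ) (rx ry rb c₀ : ℝ)
    (Sx : Finset (Balaban1983to89.Site P (j+k))) (Sy : Finset (Balaban1983to89.Site P (j+k+1))) (Sb : Finset (PBond P (j+k)))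
    (lam0 : Balaban1983to89.Site P j → ℝ) (U : GaugeField P j U1) (φ : HiggsField P (j+k)) (ψ : HiggsField P (j+k+1)) :
    (∏ x ∈ Sx, χ rx ‖bgGaugePhi ek (fun x : Balaban1983to89.Site P (j+k) => lam0 (cornerIter k x)) φ x‖) *
      (∏ y ∈ Sy, χ ry ‖bgGaugePhi ek (fun y : Balaban1983to89.Site P (j+k+1) => lam0 (cornerIter (k+1) y)) ψ y -
        qCov (barUc k (toU1Field (bgGaugeU ek η lam0 (cfg U)))) (bgGaugePhi ek (fun x : Balaban1983to89.Site P (j+k) => lam0 (cornerIter k x)) φ) y‖) *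
      (∏ b ∈ Sb, χ rb ‖covD c₀ (cfg (barUc k (toU1Field (bgGaugeU ek η lam0 (cfg U)))))
        (bgGaugePhi ek (fun x : Balaban1983to89.Site P (j+k) => lam0 (cornerIter k x)) φ) b‖) =
    (∏ x ∈ Sx, χ rx ‖φ x‖) * (∏ y ∈ Sy, χ ry ‖ψ y - qCov (barUc k (toU1Field (cfg U))) φ y‖) *
      (∏ b ∈ Sb, χ rb ‖covD c₀ (cfg (barUc k (toU1Field (cfg U)))) φ b‖) := by
  congr 1
  · congr 1
    · exact Finset.prod_congr rfl fun x _ => by rw [norm_bgGaugePhi_apply]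
    · exact Finset.prod_congr rfl fun y _ => by rw [norm_sub_qCov_barUc_bg hk hη]
  · exact Finset.prod_congr rfl fun b _ => by rw [norm_covD_barUc_bg (by omega) hη]

end Restrictions522

/-! ## §8 (v1.2, append-only) (4.9) for the concrete slot EVALUATED at every pure-gauge background — p31's `Z49_deltaLocT_flat` BY NAME -/

section ZSlotFlat

open BIJ85BlockAveragesTorusK (blockK)
open BIJ88NeumannPropagatorFlatDecayCube (cubeT)
open BIJ88NeumannNoZeroModesTorus (innerK)
open BIJ88Sect3Statements (starB)
open BIJ88Eq240FlatTorus (c240 Z49_deltaLocT_flat)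
open BIJ88Normalization46 (Z49_pos)

/-- **THE `Z^{(j)}`-SLOT `z49Slot` AT EVERY PURE-GAUGE BACKGROUND `u_k = 1^h` IS PRINT'S CONVERGENT GAUSSIAN (4.9)** — p31's
`BIJ88Eq240FlatTorus.Z49_deltaLocT_flat` (r18's `Z49_eq` with `T.PosDef` DISCHARGED by the (2.38)/(2.40) positivity of `Δ_{k,loc}` at flat
`u`, `j = k ≥ 1`) READ FOR THE SLOT of §5 / of `BIJ88Eq596BgTorus.eq596_bySteps_bgTorus` (`prec49_pureGauge`, `toU1Field_cfg`): under
p31's hypotheses VERBATIM (dimension `d+1`, `L = ℓ+1`, `1 ≤ k ≤ K`, standing range, an admissible cube family inside a reference cube, weights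
`Σ_α|λ_α| ≤ 1`, `0 ≤ ζ″ ≤ 1`, symmetric `λ_α`, `ζ″`, the separation/partition hypotheses on the rows of `Λ`, `Λ`'s bonds inside the
interior of the reference cube, `κ ≥ 0`, and the (2.38) smallness inequality), for every gauge function `h` on `T_η` and every `E_s`, `N`:
the realified compressed precision `realify((Δ_{k,loc}(1^h) + κP(ū_k(1^h)))|_Λ)` is POSITIVE DEFINITE,
`z49Slot … (cfg 1^h) = e^{−E_sN}·√(2π)^{2|Λ|}/√det(…)`, and `0 < z49Slot … (cfg 1^h)` (r18's `Z49_pos`) — at these backgrounds the slot is a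
convergent Gaussian integral, not a formal one.  Nothing new is estimated here: the analytic content is p31's, taken by name.
[cite: BalabanImbrieJaffe1988, (4.9) p.275] -/
theorem z49Slot_pureGauge_eq (d ℓ : ℕ) (hℓ : 1 ≤ ℓ) {a : ℝ} (ha : 0 < a) :
    ∃ δ₀ c₁ : ℝ, 0 < δ₀ ∧ 0 < c₁ ∧ ∀ (P : Params) (hPd : P.d = d + 1), P.L = ℓ + 1 →
      ∀ k : ℕ, 1 ≤ k → k ≤ P.K → k + 1 ≤ P.m + P.K → ∀ (c M0 : Fin (d + 1) → ℕ), (∀ i, 1 ≤ M0 i) →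
        (∀ i, c i * P.L ^ k + P.L ^ k * M0 i ≤ P.sitesPerDir 0) → (∀ i, P.L ^ k * M0 i < P.sitesPerDir 0) →
      ∀ (ι : Type) [Fintype ι] (cube : ι → Finset (Balaban1983to89.Site P 0))
        (lam : ι → Balaban1983to89.Site P 0 → Balaban1983to89.Site P 0 → ℝ)
        (ζ'' : Balaban1983to89.Site P 0 → Balaban1983to89.Site P 0 → ℝ),
        (∀ α, ∃ t M : Fin (d + 1) → ℕ, (∀ i, 1 ≤ M i) ∧ (∀ i, t i + M i ≤ M0 i) ∧
            cube α = cubeT hPd (P.L ^ k) (c + t) fun i => P.L ^ k * M i) →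
        (∀ x y, ∑ α, |lam α x y| ≤ 1) → (∀ x y, 0 ≤ ζ'' x y ∧ ζ'' x y ≤ 1) →
        (∀ α x y, lam α y x = lam α x y) → (∀ x y, ζ'' y x = ζ'' x y) →
      ∀ (h : GaugeTransf P 0 U1) (R R₁ : ℝ), 0 ≤ R → 0 ≤ R₁ → ∀ (m : ℕ) (Λ : Finset (Balaban1983to89.Site P (0 + k))),
        (∀ y₁ ∈ Λ,
          (∀ x ∈ blockK k y₁, ∀ y, ζ'' x y ≠ 0 → ∑ α, lam α x y = 1) ∧
          (∀ x ∈ blockK k y₁, ∀ α y, ζ'' x y * lam α x y ≠ 0 → x ∈ cube α ∧ y ∈ cube α ∧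
              ∀ w ∈ cubeT hPd (P.L ^ k) c (fun i => P.L ^ k * M0 i), w ∉ cube α →
                R ≤ B5Ineq137Torus.T P 0 x w ∧ R ≤ B5Ineq137Torus.T P 0 y w) ∧
          (∀ x ∈ blockK k y₁, ∀ y, B5Ineq137Torus.T P 0 x y ≤ R₁ → ζ'' x y = 1) ∧
          ∃ S : Finset ι, S.card ≤ m ∧ ∀ x ∈ blockK k y₁, ∀ α y, ζ'' x y * lam α x y ≠ 0 → α ∈ S) →
        (∀ b : PBond P (0 + k), (b.src ∈ Λ ∨ b.tgt ∈ Λ) →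
          b ∈ starB (innerK k (cubeT hPd (P.L ^ k) c fun i => P.L ^ k * M0 i))) →
      ∀ (κ : ℝ), 0 ≤ κ →
        (B1RG242Torus.α P a k * (P.L : ℝ) ^ (k * P.d)) / B1.aSeq a P.L k *
            (B1.aSeq a P.L k ^ 2 * c₁ *
              ((m : ℝ) * Real.exp (-(δ₀ * (((P.L : ℝ) ^ k)⁻¹ * (2 * R)))) + Real.exp (-(δ₀ / 2 * (((P.L : ℝ) ^ k)⁻¹ * R₁))))) <
          c240 P ((B1RG242Torus.α P a k * (P.L : ℝ) ^ (k * P.d)) / B1.aSeq a P.L k * min (B1.aSeq a P.L k / (8 * P.d)) (1 / 2)) κ →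
      ∀ (Es N : ℝ),
        (realify (compress Λ (prec49 (B1RG242Torus.α P a k * (P.L : ℝ) ^ (k * P.d)) P.eps⁻¹ (gaugeAct h (1 : GaugeField P 0 U1)) k
            cube lam ζ'' κ))).PosDef ∧
        z49Slot (B1RG242Torus.α P a k * (P.L : ℝ) ^ (k * P.d)) P.eps⁻¹ k cube lam ζ'' κ Λ Es N
            (cfg (gaugeAct h (1 : GaugeField P 0 U1))) =
          Real.exp (-(Es * N)) * (Real.sqrt (2 * Real.pi) ^ Fintype.card (↥Λ × Fin 2) /
            Real.sqrt (realify (compress Λ (prec49 (B1RG242Torus.α P a k * (P.L : ℝ) ^ (k * P.d)) P.eps⁻¹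
              (gaugeAct h (1 : GaugeField P 0 U1)) k cube lam ζ'' κ))).det) ∧
        0 < z49Slot (B1RG242Torus.α P a k * (P.L : ℝ) ^ (k * P.d)) P.eps⁻¹ k cube lam ζ'' κ Λ Es N
            (cfg (gaugeAct h (1 : GaugeField P 0 U1))) := by
  obtain ⟨δ₀, c₁, hδ₀, hc₁, H⟩ := Z49_deltaLocT_flat d ℓ hℓ ha
  refine ⟨δ₀, c₁, hδ₀, hc₁, ?_⟩
  intro P hPd hPL k hk1 hkK hk' c M0 hM0 hfit0 hN0 ι _ cube lam ζ hcube hlam hζ hlamS hζS h R R₁ hR hR₁ m Λ hrows hbonds κ hκ hsmall Es N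
  have hk : 0 + k ≤ P.m + P.K := by omega
  obtain ⟨hpd, hZ⟩ :=
    H P hPd hPL k hk1 hkK hk' c M0 hM0 hfit0 hN0 ι cube lam ζ hcube hlam hζ hlamS hζS h R R₁ hR hR₁ m Λ hrows hbonds κ hκ hsmall Es N
  rw [z49Slot, toU1Field_cfg, prec49_pureGauge hk]
  exact ⟨hpd, hZ, Z49_pos _ hpd Es N⟩

end ZSlotFlat

end

end Literature.MathematicalPhysics.QuantumFieldTheory.BalabanImbrieJaffe1984to88.BIJ88BgInvariance416Torus
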